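/-
Copyright: the b2b-balaban T⁴-continuum CRUX team, row NE7b leaf lineage `t4-ne7b-formalise-leaf-03` (gen 143). Project licence.
-/
import Mathlib.Analysis.InnerProductSpace.Adjoint
import Mathlib.LinearAlgebra.Matrix.PosDef
import Mathlib.Data.Real.Pointwise

/-!
# THE SCHUR STEP OF THE MODULUS FORM: from a COUPLED joint modulus form on `E₁ × E₂` to the SHARP BASE FORM that the windowed
# marginal inherits (`…LogConcaveMarginal` §6) — the fibrewise infimum, which for a block quadratic form IS the Schur complement
# `a − B C⁻¹ B†` (Brascamp–Lieb 1976, (4.18)); `…ConvexityModulusTransport` §5's split feeder is the uncoupled case `B = 0`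
# (row NE7b, node U5c; residual (R2′) family (2), letter (ℓ1) in FORM currency; kernel lemmas of linear ∕ convex algebra)

Cell `pub-balaban`, sub-cell `t4`, spine estimate NE7b (`T4WeightBudget.RelWeightBound`; the cell's OWN estimate — NOT PRINTED in
[Bałaban 1983–89], NOT PROVED).  Crux-route work under `Spine/NE7b/` by a row leaf on the convexity road; NOTHING of Bałaban's is named
or asserted; no `T4Continuum/Support` leaf typed; no `def`; zero `sorry`.  Imports: Mathlib only — independent of the farm's olean frontier.

WHY.  The OWNER's `…LogConcaveMarginal` §6 (`neg_log_fibreIntegral_secant_of_baseForm`, [BrascampLieb1976, Thm 4.3]) lets the windowed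
marginal `V⁺(x) = −log ∫_{K_x} e^{−V(x,·)}` inherit ANY base functional `Q₁` for which the JOINT exponent obeys the secant letter
`V(a p + b q) + a·b·Q₁(q₁ − p₁) ≤ a V(p) + b V(q)` on `K ⊆ E₁ × E₂`.  The typed feeders produce such a `Q₁` from a joint letter only when
the joint modulus form is SPLIT — `Q₁(q₁ − p₁) + Q₂(q₂ − p₂)`, the fibre share `Q₂ ≥ 0` dropped (`…ConvexityModulusTransport` §5) — or is
already base-only read through a chart (`…EuclideanCarrierSplit` §1).  The refuter's desk currency names the form an instance displays
instead: a COUPLED block form, whose inherited base form is «the Schur complement `M∕H_ff = H_bb − H_bf H_ff⁻¹ H_fb` of the block Hessian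
(BL 1976 (4.18)), never `M ⊕ H_ff`» (PRICING-NE7b v94 F486 by value; HANDOFF § refuter gen 78; κ-ne7bref-g77-1: the scalar full-norm
`λ` is volume-degenerate across steps, the Schur form self-sustaining).  THIS FILE types the step from a coupled joint form `Q` to a base
form: ANY `S` with `S(x) ≤ Q(x, y)` for all `y` passes to the base letter (§1 — one line, but it is THE step); the SHARP such `S` is the
fibrewise infimum (§3); for a block quadratic form `Q(x, y) = a(x) + 2⟪x, B y⟫ + ⟪y, C y⟫` with `C` symmetric positive semidefinite the
infimum is attained at the fibre minimiser `y = L x`, `C L = −B†`, and equals the SCHUR FORM `a(x) + ⟪x, B(L x)⟫ = a(x) − ⟪L x, C(L x)⟫`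
(§4, coordinate-free; §5, matrices, Mathlib's `Matrix.schur_complement_eq₂₂` BY NAME: `xᵀ(A − B D⁻¹ Bᵀ)x ≤ (x, y)ᵀ M (x, y)`).

WHAT IS PROVED ([folklore] linear ∕ convex algebra; Mathlib only):
* §1 **`secantForm_base_of_le`** — THE STEP (any real vector spaces): the joint secant letter with `Q` on `K ⊆ E₁ × E₂` and
  `S v.1 ≤ Q v` for all `v` ⟹ the base-form secant letter with `S` — VERBATIM the hypothesis `hVc` of `…LogConcaveMarginal` §6.
* §2 **`secant_of_firstOrderOn_prod_jointForm`** — the joint FIRST-ORDER letter with two partial fields and a JOINT 2-homogeneous form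
  `Q(q − p)` on a convex `K` ⟹ the joint secant letter with `Q` (`…ConvexityModulusTransport.secant_base_of_firstOrderOn_prod_form` is the
  split case `Q(v) = Q₁(v₁) + Q₂(v₂)`, `S = Q₁` — in the tree, not restated); `secant_base_of_firstOrderOn_prod_jointForm` (+ §1).
* §3 the SHARP base form is the fibrewise infimum `x ↦ ⨅ y, Q(x, y)`: `iInf_fibre_le` (dominated by `Q`), `le_iInf_fibre` (dominates
  every admissible base form), `iInf_fibre_smul` ∕ `iInf_fibre_nonneg` (2-homogeneous and `≥ 0` when `Q` is), `secantForm_iInf_fibre`.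
* §4 block quadratic forms on inner product spaces, `Q(x, y) = a(x) + 2⟪x, B y⟫ + ⟪y, C y⟫` (`a` ANY base functional, `B : E₂ →ₗ E₁`,
  `C : E₂ →ₗ E₂` symmetric), `L : E₁ → E₂` a fibre-minimiser map (`⟪C(L x), w⟫ = −⟪x, B w⟫`, adjoint-free for `C L = −B†`):
  `jointForm_eq_schurForm_add` (completing the square), `schurForm_eq_sub` (`a x + ⟪x, B(L x)⟫ = a x − ⟪L x, C(L x)⟫`),
  `schurForm_le_jointForm` (`C ≥ 0`), `jointForm_fibreMin` (attained), `iInf_jointForm_eq_schurForm` (§3's infimum IS the Schur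
  form), `exists_fibreMin` (finite dimension, `C` bijective: `L = −C⁻¹ ∘ B†`), `bijective_of_inner_pos` (`C > 0` ⟹ bijective).
* §5 matrix currency: `schur_dotProduct_le` — `x ⬝ᵥ (A − B D⁻¹ Bᵀ) x ≤ (x ⊕ᵥ y) ⬝ᵥ (fromBlocks A B Bᵀ D)(x ⊕ᵥ y)` for `D` positive
  definite (Mathlib's `Matrix.schur_complement_eq₂₂` + `D ≥ 0`), `schur_dotProduct_eq_fibreMin` (equality at `y = −D⁻¹Bᵀx`).
* §6 END **`secantForm_schur_of_jointBlockForm`** (§4 + §1: the joint secant letter with the block form ⟹ the base letter with the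
  Schur form, in `…LogConcaveMarginal` §6's shape) and **`secantForm_schur_of_firstOrderOn_jointBlockForm`** (from the joint first-order
  letter, §2 + §4 + §1).
* §7 (v2, appended) **`iInf_fibre_tower`** — THE SCHUR TOWER IS ONE STEP: for `Q ≥ 0` on `E₁ × (E₂ × E₃)`,
  `⨅ y, ⨅ z, Q(x, (y, z)) = ⨅ w, Q(x, w)` (eliminating `E₃` then `E₂` by §3's sharp form = eliminating `E₂ × E₃` at once — the quotient
  identity of successive Schur complements in sharp-form currency; chair leaf-05 g148's junction glue JS3, folded in);
  `secantForm_iInf_fibre_tower` (+ §1).  Honest note on §4 (refuter ι-ne7bref-g79-3 ∕ chair ι-X-CMS-g148-2): for `C` only SEMIdefinite a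
  fibre minimiser `L` with `C L = −B†` exists iff `range B† ⊆ range C`; otherwise the joint form is unbounded below on some fibre and NO
  base form exists — §4 takes `L` as data, `exists_fibreMin` supplies it for `C` bijective (`C > 0` in finite dimension).

NOT HERE (honest): WHICH block form Bałaban's exponents display on WHICH coordinates at WHICH step, and the Schur complements by value —
(A3) ∕ (A1c) readings, NC-NE7b-α UNRULED; the marginal itself (`…LogConcaveMarginal` §6, joined BY SHAPE: this file's END conclusion is
its `hVc`); anything of Bałaban's.  BY-NAME EFFECT ON THE WALL: NONE.  NE7b NOT PRINTED ∕ NOT PROVED; spine PROVED 0∕9; rung (B)+1 on a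
FINITE torus — NOT infinite volume, NOT the mass gap, NOT Clay.
HONEST DEPENDENCY: continuum YM on T⁴ ⇐ BetaPertH ∧ nine spine estimates (0/9 proved); BetaPertH ⇐ (D1) ∧ (D4) ∧ CAP+tail.
-/

set_option autoImplicit false

open Set Function
open scoped RealInnerProductSpace Matrix

namespace Summit.QuantumFields.BalabanUV.T4Continuum.NE7b.ConvexityModulusSchur

/-! ## §1 THE STEP: a joint form dominating a base form on every fibre passes the base form to the secant letter -/

section Base

variable {E₁ E₂ : Type*} [AddCommGroup E₁] [Module ℝ E₁] [AddCommGroup E₂] [Module ℝ E₂]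

/-- **THE SCHUR STEP IN SECANT CURRENCY**: if `V` obeys the secant letter on `K ⊆ E₁ × E₂` with a JOINT modulus form `Q`,
`V(a p + b q) + a·b·Q(q − p) ≤ a V(p) + b V(q)`, and `S` is a base form with `S(v₁) ≤ Q(v)` for every `v`, then `V` obeys the letter with
the base form `S(q₁ − p₁)` — verbatim the hypothesis `hVc` of `…LogConcaveMarginal.neg_log_fibreIntegral_secant_of_baseForm`. [folklore] -/
theorem secantForm_base_of_le {K : Set (E₁ × E₂)} {V Q : E₁ × E₂ → ℝ} {S : E₁ → ℝ} (hSQ : ∀ v : E₁ × E₂, S v.1 ≤ Q v)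
    (h : ∀ p ∈ K, ∀ q ∈ K, ∀ a b : ℝ, 0 ≤ a → 0 ≤ b → a + b = 1 → V (a • p + b • q) + a * b * Q (q - p) ≤ a * V p + b * V q) :
    ∀ p ∈ K, ∀ q ∈ K, ∀ a b : ℝ, 0 ≤ a → 0 ≤ b → a + b = 1 →
      V (a • p + b • q) + a * b * S (q.1 - p.1) ≤ a * V p + b * V q := by
  intro p hp q hq a b ha hb hab
  have key := h p hp q hq a b ha hb hab
  have hle : S (q.1 - p.1) ≤ Q (q - p) := by simpa only [Prod.fst_sub] using hSQ (q - p)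
  nlinarith [mul_nonneg ha hb]

/-- The same step for a joint form that dominates a SPLIT pair: `S(v₁) + T(v₂) ≤ Q(v)` with `T ≥ 0` ⟹ the base letter with `S`. [folklore] -/
theorem secantForm_base_of_split_le {K : Set (E₁ × E₂)} {V Q : E₁ × E₂ → ℝ} {S : E₁ → ℝ} {T : E₂ → ℝ}
    (hST : ∀ v : E₁ × E₂, S v.1 + T v.2 ≤ Q v) (hT : ∀ w, 0 ≤ T w)
    (h : ∀ p ∈ K, ∀ q ∈ K, ∀ a b : ℝ, 0 ≤ a → 0 ≤ b → a + b = 1 → V (a • p + b • q) + a * b * Q (q - p) ≤ a * V p + b * V q) :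
    ∀ p ∈ K, ∀ q ∈ K, ∀ a b : ℝ, 0 ≤ a → 0 ≤ b → a + b = 1 →
      V (a • p + b • q) + a * b * S (q.1 - p.1) ≤ a * V p + b * V q :=
  secantForm_base_of_le (fun v => by linarith [hST v, hT v.2]) h

end Base

/-! ## §2 The joint FIRST-ORDER letter with two partial fields and a JOINT (coupled) form gives the joint secant letter -/

section JointField

variable {E₁ E₂ : Type*} [NormedAddCommGroup E₁] [InnerProductSpace ℝ E₁] [NormedAddCommGroup E₂] [InnerProductSpace ℝ E₂]

/-- **JOINT FIRST-ORDER LETTER WITH A JOINT FORM ⟹ JOINT SECANT LETTER**: on a convex `K ⊆ E₁ × E₂`,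
`V p + ⟪d₁V p, q₁ − p₁⟫ + ⟪d₂V p, q₂ − p₂⟫ + Q(q − p) ≤ V q` with `Q` 2-homogeneous on `E₁ × E₂` (coupled forms allowed) ⟹
`V(a p + b q) + a·b·Q(q − p) ≤ a V p + b V q` (`…ConvexityModulusTransport` §5 is the split case `Q(v) = Q₁(v₁) + Q₂(v₂)`). [folklore] -/
theorem secant_of_firstOrderOn_prod_jointForm {K : Set (E₁ × E₂)} (hK : Convex ℝ K) {V : E₁ × E₂ → ℝ} {dV₁ : E₁ × E₂ → E₁}
    {dV₂ : E₁ × E₂ → E₂} (Q : E₁ × E₂ → ℝ) (hQ : ∀ (t : ℝ) (v : E₁ × E₂), Q (t • v) = t ^ 2 * Q v)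
    (h : ∀ p ∈ K, ∀ q ∈ K, V p + ⟪dV₁ p, q.1 - p.1⟫ + ⟪dV₂ p, q.2 - p.2⟫ + Q (q - p) ≤ V q) :
    ∀ p ∈ K, ∀ q ∈ K, ∀ a b : ℝ, 0 ≤ a → 0 ≤ b → a + b = 1 →
      V (a • p + b • q) + a * b * Q (q - p) ≤ a * V p + b * V q := by
  intro p hp q hq a b ha hb hab
  have ha' : a = 1 - b := by linarith
  subst ha'
  have hz : (1 - b) • p + b • q ∈ K := hK hp hq ha hb hab
  have h1 := h _ hz p hp
  have h2 := h _ hz q hq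
  have e1 : p - ((1 - b) • p + b • q) = (-b) • (q - p) := by
    simp only [sub_smul, one_smul, smul_sub, neg_smul]; abel
  have e2 : q - ((1 - b) • p + b • q) = (1 - b) • (q - p) := by
    simp only [sub_smul, one_smul, smul_sub]; abel
  rw [← Prod.fst_sub, ← Prod.snd_sub, e1, Prod.smul_fst, Prod.smul_snd, inner_smul_right, inner_smul_right, hQ] at h1
  rw [← Prod.fst_sub, ← Prod.snd_sub, e2, Prod.smul_fst, Prod.smul_snd, inner_smul_right, inner_smul_right, hQ] at h2
  have hsum := add_le_add (mul_le_mul_of_nonneg_left h1 ha) (mul_le_mul_of_nonneg_left h2 hb)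
  linear_combination hsum

/-- **… AND THEN THE BASE LETTER** with any base form `S` dominated by `Q` on every fibre (§2 + §1). [folklore] -/
theorem secant_base_of_firstOrderOn_prod_jointForm {K : Set (E₁ × E₂)} (hK : Convex ℝ K) {V : E₁ × E₂ → ℝ} {dV₁ : E₁ × E₂ → E₁}
    {dV₂ : E₁ × E₂ → E₂} (Q : E₁ × E₂ → ℝ) (hQ : ∀ (t : ℝ) (v : E₁ × E₂), Q (t • v) = t ^ 2 * Q v) {S : E₁ → ℝ}
    (hSQ : ∀ v : E₁ × E₂, S v.1 ≤ Q v)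
    (h : ∀ p ∈ K, ∀ q ∈ K, V p + ⟪dV₁ p, q.1 - p.1⟫ + ⟪dV₂ p, q.2 - p.2⟫ + Q (q - p) ≤ V q) :
    ∀ p ∈ K, ∀ q ∈ K, ∀ a b : ℝ, 0 ≤ a → 0 ≤ b → a + b = 1 →
      V (a • p + b • q) + a * b * S (q.1 - p.1) ≤ a * V p + b * V q :=
  secantForm_base_of_le hSQ (secant_of_firstOrderOn_prod_jointForm hK Q hQ h)

end JointField

/-! ## §3 The SHARP base form is the fibrewise infimum -/

section Infimal

variable {E₁ E₂ : Type*}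

/-- The fibrewise infimum `x ↦ ⨅ y, Q(x, y)` is dominated by `Q` (on fibres where `Q(x, ·)` is bounded below). [folklore] -/
theorem iInf_fibre_le (Q : E₁ × E₂ → ℝ) {x : E₁} (hbdd : BddBelow (range fun y : E₂ => Q (x, y))) (y : E₂) :
    (⨅ y', Q (x, y')) ≤ Q (x, y) :=
  ciInf_le hbdd y

/-- … and it DOMINATES every admissible base form: `S(v₁) ≤ Q(v)` for all `v` ⟹ `S x ≤ ⨅ y, Q(x, y)` (sharpness). [folklore] -/
theorem le_iInf_fibre [Nonempty E₂] (Q : E₁ × E₂ → ℝ) {S : E₁ → ℝ} (hSQ : ∀ v : E₁ × E₂, S v.1 ≤ Q v) (x : E₁) :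
    S x ≤ ⨅ y, Q (x, y) :=
  le_ciInf fun y => hSQ (x, y)

/-- For `Q ≥ 0` every fibre is bounded below, so the infimal form is admissible: `⨅ y', Q(x, y') ≤ Q(x, y)`. [folklore] -/
theorem iInf_fibre_le_of_nonneg (Q : E₁ × E₂ → ℝ) (hQ0 : ∀ v, 0 ≤ Q v) (v : E₁ × E₂) : (⨅ y, Q (v.1, y)) ≤ Q v :=
  ciInf_le ⟨0, forall_mem_range.2 fun _ => hQ0 _⟩ v.2

/-- The infimal form of a non-negative form is non-negative. [folklore] -/
theorem iInf_fibre_nonneg [Nonempty E₂] (Q : E₁ × E₂ → ℝ) (hQ0 : ∀ v, 0 ≤ Q v) (x : E₁) : 0 ≤ ⨅ y, Q (x, y) :=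
  le_ciInf fun _ => hQ0 _

variable [AddCommGroup E₁] [Module ℝ E₁] [AddCommGroup E₂] [Module ℝ E₂]

/-- **THE INFIMAL FORM OF A 2-HOMOGENEOUS NON-NEGATIVE FORM IS 2-HOMOGENEOUS** (so it re-enters `…ConvexityModulusTransport` §3 ∕
`…StrongConvexSubgradientField` §5 where a homogeneous base form is wanted). [folklore] -/
theorem iInf_fibre_smul (Q : E₁ × E₂ → ℝ) (hQ : ∀ (t : ℝ) (v : E₁ × E₂), Q (t • v) = t ^ 2 * Q v) (hQ0 : ∀ v, 0 ≤ Q v)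
    (t : ℝ) (x : E₁) : (⨅ y, Q (t • x, y)) = t ^ 2 * ⨅ y, Q (x, y) := by
  rcases eq_or_ne t 0 with rfl | ht
  · have h00 : Q (0 : E₁ × E₂) = 0 := by
      have := hQ 0 (0 : E₁ × E₂)
      simpa using this
    rw [zero_smul, sq, zero_mul, zero_mul]
    refine le_antisymm ?_ (iInf_fibre_nonneg Q hQ0 0)
    calc (⨅ y, Q ((0 : E₁), y)) ≤ Q ((0 : E₁), (0 : E₂)) := ciInf_le ⟨0, forall_mem_range.2 fun _ => hQ0 _⟩ 0
      _ = 0 := by rw [Prod.mk_zero_zero]; exact h00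
  · have hs : Surjective fun y' : E₂ => t • y' := fun y => ⟨t⁻¹ • y, by simp [smul_smul, mul_inv_cancel₀ ht]⟩
    calc (⨅ y, Q (t • x, y)) = ⨅ y', Q (t • x, t • y') := (hs.iInf_comp fun y => Q (t • x, y)).symm
      _ = ⨅ y', t ^ 2 * Q (x, y') := by
          refine iInf_congr fun y' => ?_
          rw [← hQ t (x, y'), Prod.smul_mk]
      _ = t ^ 2 * ⨅ y', Q (x, y') := (Real.mul_iInf_of_nonneg (sq_nonneg t) _).symm

/-- §1 fed with the sharp form: the joint secant letter with `Q ≥ 0` ⟹ the base letter with `x ↦ ⨅ y, Q(x, y)`. [folklore] -/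
theorem secantForm_iInf_fibre {K : Set (E₁ × E₂)} {V Q : E₁ × E₂ → ℝ} (hQ0 : ∀ v, 0 ≤ Q v)
    (h : ∀ p ∈ K, ∀ q ∈ K, ∀ a b : ℝ, 0 ≤ a → 0 ≤ b → a + b = 1 → V (a • p + b • q) + a * b * Q (q - p) ≤ a * V p + b * V q) :
    ∀ p ∈ K, ∀ q ∈ K, ∀ a b : ℝ, 0 ≤ a → 0 ≤ b → a + b = 1 →
      V (a • p + b • q) + a * b * (⨅ y, Q (q.1 - p.1, y)) ≤ a * V p + b * V q :=
  secantForm_base_of_le (S := fun x => ⨅ y, Q (x, y)) (iInf_fibre_le_of_nonneg Q hQ0) h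

end Infimal

/-! ## §4 Block quadratic forms, coordinate-free: completing the square, the Schur form, the fibre minimiser -/

section Block

variable {E₁ E₂ : Type*} [NormedAddCommGroup E₁] [InnerProductSpace ℝ E₁] [NormedAddCommGroup E₂] [InnerProductSpace ℝ E₂]

/-- **COMPLETING THE SQUARE**: for ANY base functional `a`, a coupling `B : E₂ →ₗ[ℝ] E₁`, a SYMMETRIC fibre operator `C` and a
fibre-minimiser map `L` with `⟪C(L x), w⟫ = −⟪x, B w⟫` (i.e. `C L = −B†`):
`a x + 2⟪x, B y⟫ + ⟪y, C y⟫ = (a x + ⟪x, B(L x)⟫) + ⟪y − L x, C(y − L x)⟫`. [folklore] -/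
theorem jointForm_eq_schurForm_add (a : E₁ → ℝ) (B : E₂ →ₗ[ℝ] E₁) (C : E₂ →ₗ[ℝ] E₂) (hC : ∀ u w : E₂, ⟪C u, w⟫ = ⟪u, C w⟫)
    (L : E₁ → E₂) (hL : ∀ (x : E₁) (w : E₂), ⟪C (L x), w⟫ = -⟪x, B w⟫) (x : E₁) (y : E₂) :
    a x + 2 * ⟪x, B y⟫ + ⟪y, C y⟫ = (a x + ⟪x, B (L x)⟫) + ⟪y - L x, C (y - L x)⟫ := by
  have h1 : ⟪y, C (L x)⟫ = -⟪x, B y⟫ := by rw [real_inner_comm, hL]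
  have h2 : ⟪L x, C y⟫ = -⟪x, B y⟫ := by rw [← hC, hL]
  have h3 : ⟪L x, C (L x)⟫ = -⟪x, B (L x)⟫ := by rw [← hC, hL]
  rw [map_sub, inner_sub_left, inner_sub_right, inner_sub_right, h1, h2, h3]
  ring

/-- The Schur form as a DECREMENT of the base block: `a x + ⟪x, B(L x)⟫ = a x − ⟪L x, C(L x)⟫` (`= a(x) − ⟪B†x, C⁻¹B†x⟫`). [folklore] -/
theorem schurForm_eq_sub (a : E₁ → ℝ) (B : E₂ →ₗ[ℝ] E₁) (C : E₂ →ₗ[ℝ] E₂) (hC : ∀ u w : E₂, ⟪C u, w⟫ = ⟪u, C w⟫)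
    (L : E₁ → E₂) (hL : ∀ (x : E₁) (w : E₂), ⟪C (L x), w⟫ = -⟪x, B w⟫) (x : E₁) :
    a x + ⟪x, B (L x)⟫ = a x - ⟪L x, C (L x)⟫ := by
  have h3 : ⟪L x, C (L x)⟫ = -⟪x, B (L x)⟫ := by rw [← hC, hL]
  rw [h3]; ring

/-- **THE SCHUR FORM IS DOMINATED BY THE JOINT FORM** when the fibre operator is positive semidefinite. [folklore] -/
theorem schurForm_le_jointForm (a : E₁ → ℝ) (B : E₂ →ₗ[ℝ] E₁) (C : E₂ →ₗ[ℝ] E₂) (hC : ∀ u w : E₂, ⟪C u, w⟫ = ⟪u, C w⟫)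
    (hC0 : ∀ w : E₂, 0 ≤ ⟪w, C w⟫) (L : E₁ → E₂) (hL : ∀ (x : E₁) (w : E₂), ⟪C (L x), w⟫ = -⟪x, B w⟫) (x : E₁) (y : E₂) :
    a x + ⟪x, B (L x)⟫ ≤ a x + 2 * ⟪x, B y⟫ + ⟪y, C y⟫ := by
  rw [jointForm_eq_schurForm_add a B C hC L hL x y]
  linarith [hC0 (y - L x)]

/-- The joint form AT the fibre minimiser equals the Schur form (the infimum is attained). [folklore] -/
theorem jointForm_fibreMin (a : E₁ → ℝ) (B : E₂ →ₗ[ℝ] E₁) (C : E₂ →ₗ[ℝ] E₂) (hC : ∀ u w : E₂, ⟪C u, w⟫ = ⟪u, C w⟫)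
    (L : E₁ → E₂) (hL : ∀ (x : E₁) (w : E₂), ⟪C (L x), w⟫ = -⟪x, B w⟫) (x : E₁) :
    a x + 2 * ⟪x, B (L x)⟫ + ⟪L x, C (L x)⟫ = a x + ⟪x, B (L x)⟫ := by
  rw [jointForm_eq_schurForm_add a B C hC L hL x (L x), sub_self, map_zero, inner_zero_right, add_zero]

/-- **§3's SHARP FORM IS THE SCHUR FORM**: `⨅ y, (a x + 2⟪x, B y⟫ + ⟪y, C y⟫) = a x + ⟪x, B(L x)⟫` for `C` symmetric positive semidefinite
with a fibre minimiser `L`. [folklore] -/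
theorem iInf_jointForm_eq_schurForm (a : E₁ → ℝ) (B : E₂ →ₗ[ℝ] E₁) (C : E₂ →ₗ[ℝ] E₂) (hC : ∀ u w : E₂, ⟪C u, w⟫ = ⟪u, C w⟫)
    (hC0 : ∀ w : E₂, 0 ≤ ⟪w, C w⟫) (L : E₁ → E₂) (hL : ∀ (x : E₁) (w : E₂), ⟪C (L x), w⟫ = -⟪x, B w⟫) (x : E₁) :
    (⨅ y, (a x + 2 * ⟪x, B y⟫ + ⟪y, C y⟫)) = a x + ⟪x, B (L x)⟫ := by
  refine le_antisymm ?_ (le_ciInf fun y => schurForm_le_jointForm a B C hC hC0 L hL x y)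
  calc (⨅ y, (a x + 2 * ⟪x, B y⟫ + ⟪y, C y⟫)) ≤ a x + 2 * ⟪x, B (L x)⟫ + ⟪L x, C (L x)⟫ :=
        ciInf_le ⟨a x + ⟪x, B (L x)⟫, forall_mem_range.2 fun y => schurForm_le_jointForm a B C hC hC0 L hL x y⟩ (L x)
    _ = a x + ⟪x, B (L x)⟫ := jointForm_fibreMin a B C hC L hL x

/-- A positive definite symmetric operator on a finite-dimensional space is bijective (so a fibre minimiser exists, next lemma). [folklore] -/
theorem bijective_of_inner_pos [FiniteDimensional ℝ E₂] (C : E₂ →ₗ[ℝ] E₂) (hCpos : ∀ w : E₂, w ≠ 0 → 0 < ⟪w, C w⟫) :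
    Bijective C := by
  have hinj : Injective C := by
    intro u w huw
    by_contra hne
    have hpos := hCpos (u - w) (sub_ne_zero.2 hne)
    rw [map_sub, huw, sub_self, inner_zero_right] at hpos
    exact lt_irrefl _ hpos
  exact ⟨hinj, LinearMap.surjective_of_injective hinj⟩

/-- **THE FIBRE MINIMISER EXISTS** in finite dimension for a bijective fibre operator: `L = −C⁻¹ ∘ B†` (Mathlib's `LinearMap.adjoint`)
satisfies `⟪C(L x), w⟫ = −⟪x, B w⟫`, and is linear. [folklore] -/
theorem exists_fibreMin [FiniteDimensional ℝ E₁] [FiniteDimensional ℝ E₂] (B : E₂ →ₗ[ℝ] E₁) (C : E₂ →ₗ[ℝ] E₂)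
    (hCb : Bijective C) : ∃ L : E₁ →ₗ[ℝ] E₂, ∀ (x : E₁) (w : E₂), ⟪C (L x), w⟫ = -⟪x, B w⟫ := by
  refine ⟨-((LinearEquiv.ofBijective C hCb).symm.toLinearMap ∘ₗ LinearMap.adjoint B), fun x w => ?_⟩
  have happ : C ((LinearEquiv.ofBijective C hCb).symm (LinearMap.adjoint B x)) = LinearMap.adjoint B x :=
    (LinearEquiv.ofBijective C hCb).apply_symm_apply _
  rw [LinearMap.neg_apply, map_neg, inner_neg_left, LinearMap.comp_apply, LinearEquiv.coe_toLinearMap, happ,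
    LinearMap.adjoint_inner_left]

end Block

/-! ## §5 Matrix currency: the Schur complement `A − B D⁻¹ Bᵀ` (Mathlib's `Matrix.schur_complement_eq₂₂` BY NAME) -/

section MatrixForm

variable {m n : Type*} [Fintype m] [Fintype n] [DecidableEq n]

/-- **`xᵀ(A − B D⁻¹ Bᵀ)x ≤ (x ⊕ᵥ y)ᵀ [[A, B], [Bᵀ, D]] (x ⊕ᵥ y)`** for `D` positive definite (the base block FIRST, the fibre block `D`
eliminated; Brascamp–Lieb 1976 (4.18) names this complement as the marginal's modulus form). [folklore] -/
theorem schur_dotProduct_le (A : Matrix m m ℝ) (B : Matrix m n ℝ) {D : Matrix n n ℝ} (hD : D.PosDef) (x : m → ℝ) (y : n → ℝ) :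
    x ⬝ᵥ (A - B * D⁻¹ * Bᵀ) *ᵥ x ≤ Sum.elim x y ⬝ᵥ (Matrix.fromBlocks A B Bᵀ D) *ᵥ Sum.elim x y := by
  letI : Invertible D := hD.isUnit.invertible
  have key := Matrix.schur_complement_eq₂₂ A B x y hD.isHermitian
  simp only [star_trivial, Matrix.conjTranspose_eq_transpose_of_trivial] at key
  have hnn : 0 ≤ ((D⁻¹ * Bᵀ) *ᵥ x + y) ᵥ* D ⬝ᵥ ((D⁻¹ * Bᵀ) *ᵥ x + y) := by
    have h := (Matrix.posSemidef_iff_dotProduct_mulVec.mp hD.posSemidef).2 ((D⁻¹ * Bᵀ) *ᵥ x + y)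
    rwa [star_trivial, Matrix.dotProduct_mulVec] at h
  rw [Matrix.dotProduct_mulVec, Matrix.dotProduct_mulVec, key]
  linarith

/-- Equality at the fibre minimiser `y = −D⁻¹Bᵀx`: the bound of `schur_dotProduct_le` is attained. [folklore] -/
theorem schur_dotProduct_eq_fibreMin (A : Matrix m m ℝ) (B : Matrix m n ℝ) {D : Matrix n n ℝ} (hD : D.PosDef) (x : m → ℝ) :
    Sum.elim x (-((D⁻¹ * Bᵀ) *ᵥ x)) ⬝ᵥ (Matrix.fromBlocks A B Bᵀ D) *ᵥ Sum.elim x (-((D⁻¹ * Bᵀ) *ᵥ x)) =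
      x ⬝ᵥ (A - B * D⁻¹ * Bᵀ) *ᵥ x := by
  letI : Invertible D := hD.isUnit.invertible
  have key := Matrix.schur_complement_eq₂₂ A B x (-((D⁻¹ * Bᵀ) *ᵥ x)) hD.isHermitian
  simp only [star_trivial, Matrix.conjTranspose_eq_transpose_of_trivial, add_neg_cancel, Matrix.zero_vecMul,
    zero_dotProduct, zero_add] at key
  rw [Matrix.dotProduct_mulVec, Matrix.dotProduct_mulVec, key]

/-- §1 in matrix currency: the joint secant letter on `K ⊆ (m → ℝ) × (n → ℝ)` with the block form `v ↦ (v₁ ⊕ᵥ v₂)ᵀ M (v₁ ⊕ᵥ v₂)`,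
`M = [[A, B], [Bᵀ, D]]`, `D` positive definite ⟹ the base letter with the Schur complement `xᵀ(A − B D⁻¹ Bᵀ)x`. [folklore] -/
theorem secantForm_schurComplement {A : Matrix m m ℝ} {B : Matrix m n ℝ} {D : Matrix n n ℝ} (hD : D.PosDef)
    {K : Set ((m → ℝ) × (n → ℝ))} {V : (m → ℝ) × (n → ℝ) → ℝ}
    (h : ∀ p ∈ K, ∀ q ∈ K, ∀ a b : ℝ, 0 ≤ a → 0 ≤ b → a + b = 1 →
      V (a • p + b • q) + a * b * (Sum.elim (q - p).1 (q - p).2 ⬝ᵥ (Matrix.fromBlocks A B Bᵀ D) *ᵥ Sum.elim (q - p).1 (q - p).2) ≤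
        a * V p + b * V q) :
    ∀ p ∈ K, ∀ q ∈ K, ∀ a b : ℝ, 0 ≤ a → 0 ≤ b → a + b = 1 →
      V (a • p + b • q) + a * b * ((q.1 - p.1) ⬝ᵥ (A - B * D⁻¹ * Bᵀ) *ᵥ (q.1 - p.1)) ≤ a * V p + b * V q :=
  secantForm_base_of_le (Q := fun v => Sum.elim v.1 v.2 ⬝ᵥ (Matrix.fromBlocks A B Bᵀ D) *ᵥ Sum.elim v.1 v.2)
    (S := fun x => x ⬝ᵥ (A - B * D⁻¹ * Bᵀ) *ᵥ x) (fun v => schur_dotProduct_le A B hD v.1 v.2) h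

end MatrixForm

/-! ## §6 END: the joint letter with a coupled block form feeds `…LogConcaveMarginal` §6 with the SCHUR form -/

section End

variable {E₁ E₂ : Type*} [NormedAddCommGroup E₁] [InnerProductSpace ℝ E₁] [NormedAddCommGroup E₂] [InnerProductSpace ℝ E₂]

/-- **END (secant entry)**: the joint secant letter on `K ⊆ E₁ × E₂` with the COUPLED block form
`v ↦ a(v₁) + 2⟪v₁, B v₂⟫ + ⟪v₂, C v₂⟫` (`C` symmetric positive semidefinite, `L` a fibre minimiser) ⟹ the base-form letter with the
SCHUR form `x ↦ a(x) + ⟪x, B(L x)⟫` — with `E₁ = ℝᵐ`, `E₂ = ℝⁿ` this is `…LogConcaveMarginal.neg_log_fibreIntegral_secant_of_baseForm`'s `hVc`,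
so the windowed marginal inherits the Schur form (BL 1976 (4.18)), not the bare base block. [folklore] -/
theorem secantForm_schur_of_jointBlockForm (a : E₁ → ℝ) (B : E₂ →ₗ[ℝ] E₁) (C : E₂ →ₗ[ℝ] E₂) (hC : ∀ u w : E₂, ⟪C u, w⟫ = ⟪u, C w⟫)
    (hC0 : ∀ w : E₂, 0 ≤ ⟪w, C w⟫) (L : E₁ → E₂) (hL : ∀ (x : E₁) (w : E₂), ⟪C (L x), w⟫ = -⟪x, B w⟫)
    {K : Set (E₁ × E₂)} {V : E₁ × E₂ → ℝ}
    (h : ∀ p ∈ K, ∀ q ∈ K, ∀ a' b : ℝ, 0 ≤ a' → 0 ≤ b → a' + b = 1 →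
      V (a' • p + b • q) + a' * b * (a (q - p).1 + 2 * ⟪(q - p).1, B (q - p).2⟫ + ⟪(q - p).2, C (q - p).2⟫) ≤ a' * V p + b * V q) :
    ∀ p ∈ K, ∀ q ∈ K, ∀ a' b : ℝ, 0 ≤ a' → 0 ≤ b → a' + b = 1 →
      V (a' • p + b • q) + a' * b * (a (q.1 - p.1) + ⟪q.1 - p.1, B (L (q.1 - p.1))⟫) ≤ a' * V p + b * V q :=
  secantForm_base_of_le (Q := fun v => a v.1 + 2 * ⟪v.1, B v.2⟫ + ⟪v.2, C v.2⟫) (S := fun x => a x + ⟪x, B (L x)⟫)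
    (fun v => schurForm_le_jointForm a B C hC hC0 L hL v.1 v.2) h

/-- **END (first-order entry)**: the joint FIRST-ORDER letter with two partial fields and the coupled block form (`a` 2-homogeneous)
⟹ the base-form secant letter with the Schur form (§2 + §4 + §1). [folklore] -/
theorem secantForm_schur_of_firstOrderOn_jointBlockForm (a : E₁ → ℝ) (ha : ∀ (t : ℝ) (x : E₁), a (t • x) = t ^ 2 * a x)
    (B : E₂ →ₗ[ℝ] E₁) (C : E₂ →ₗ[ℝ] E₂) (hC : ∀ u w : E₂, ⟪C u, w⟫ = ⟪u, C w⟫) (hC0 : ∀ w : E₂, 0 ≤ ⟪w, C w⟫) (L : E₁ → E₂)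
    (hL : ∀ (x : E₁) (w : E₂), ⟪C (L x), w⟫ = -⟪x, B w⟫) {K : Set (E₁ × E₂)} (hK : Convex ℝ K) {V : E₁ × E₂ → ℝ}
    {dV₁ : E₁ × E₂ → E₁} {dV₂ : E₁ × E₂ → E₂}
    (h : ∀ p ∈ K, ∀ q ∈ K, V p + ⟪dV₁ p, q.1 - p.1⟫ + ⟪dV₂ p, q.2 - p.2⟫ +
      (a (q - p).1 + 2 * ⟪(q - p).1, B (q - p).2⟫ + ⟪(q - p).2, C (q - p).2⟫) ≤ V q) :
    ∀ p ∈ K, ∀ q ∈ K, ∀ a' b : ℝ, 0 ≤ a' → 0 ≤ b → a' + b = 1 →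
      V (a' • p + b • q) + a' * b * (a (q.1 - p.1) + ⟪q.1 - p.1, B (L (q.1 - p.1))⟫) ≤ a' * V p + b * V q := by
  refine secant_base_of_firstOrderOn_prod_jointForm hK (fun v => a v.1 + 2 * ⟪v.1, B v.2⟫ + ⟪v.2, C v.2⟫) (fun t v => ?_)
    (S := fun x => a x + ⟪x, B (L x)⟫) (fun v => schurForm_le_jointForm a B C hC hC0 L hL v.1 v.2) h
  simp only [Prod.smul_fst, Prod.smul_snd, ha, map_smul, inner_smul_left, inner_smul_right, RCLike.conj_to_real]
  ring

end End

/-! ## §7 (v2, appended): THE SCHUR TOWER IS ONE STEP — successive fibre eliminations = one elimination of the product fibre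
(chair leaf-05 g148's junction glue JS3 ∕ JS3', folded in under this file's names; refuter v99 F505 «k Schur steps = ONE complement over all
integrated blocks»).  Honest note on §4 (ι-ne7bref-g79-3 ∕ ι-X-CMS-g148-2): with `C` only semidefinite, `C L = −B†` is solvable iff
`range B† ⊆ range C`; otherwise some fibre infimum is `−∞` and no base form exists — §4 takes `L` as DATA, `exists_fibreMin` gives it for
`C` bijective. -/

section Tower

variable {E₁ E₂ E₃ : Type*}

/-- **THE SCHUR TOWER IS ONE STEP** (sharp-form currency): for a non-negative joint form `Q` on `E₁ × (E₂ × E₃)`, eliminating the fibre `E₃`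
first (§3's sharp form `(x, y) ↦ ⨅ z, Q(x, (y, z))`) and then `E₂` gives the same base form as eliminating `E₂ × E₃` at once:
`⨅ y, ⨅ z, Q(x, (y, z)) = ⨅ w, Q(x, w)`.  With positive definite fibre operators each infimum is a Schur form (`iInf_jointForm_eq_schurForm`),
so this is the quotient identity `(M∕M₃₃)∕(M∕M₃₃)₂₂ = M∕M_{(23)(23)}` without matrices. [folklore] -/
theorem iInf_fibre_tower [Nonempty E₂] [Nonempty E₃] (Q : E₁ × (E₂ × E₃) → ℝ) (hQ0 : ∀ v, 0 ≤ Q v) (x : E₁) :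
    (⨅ y : E₂, ⨅ z : E₃, Q (x, (y, z))) = ⨅ w : E₂ × E₃, Q (x, w) := by
  have hz : ∀ y : E₂, BddBelow (range fun z : E₃ => Q (x, (y, z))) := fun y => ⟨0, forall_mem_range.2 fun _ => hQ0 _⟩
  have hy : BddBelow (range fun y : E₂ => ⨅ z : E₃, Q (x, (y, z))) :=
    ⟨0, forall_mem_range.2 fun _ => le_ciInf fun _ => hQ0 _⟩
  have hw : BddBelow (range fun w : E₂ × E₃ => Q (x, w)) := ⟨0, forall_mem_range.2 fun _ => hQ0 _⟩
  refine le_antisymm (le_ciInf fun w => ?_) (le_ciInf fun y => le_ciInf fun z => ciInf_le hw (y, z))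
  exact (ciInf_le hy w.1).trans (ciInf_le (hz w.1) w.2)

/-- §1 fed with the two-step sharp form: the joint secant letter with `Q ≥ 0` on `K ⊆ E₁ × (E₂ × E₃)` ⟹ the base letter with
`x ↦ ⨅ y, ⨅ z, Q(x, (y, z))` — a TOWER of fibre eliminations carries ONE Schur-type base form, not a product of per-step losses. [folklore] -/
theorem secantForm_iInf_fibre_tower [AddCommGroup E₁] [Module ℝ E₁] [AddCommGroup E₂] [Module ℝ E₂] [AddCommGroup E₃] [Module ℝ E₃]
    {K : Set (E₁ × (E₂ × E₃))} {V Q : E₁ × (E₂ × E₃) → ℝ} (hQ0 : ∀ v, 0 ≤ Q v)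
    (h : ∀ p ∈ K, ∀ q ∈ K, ∀ a b : ℝ, 0 ≤ a → 0 ≤ b → a + b = 1 → V (a • p + b • q) + a * b * Q (q - p) ≤ a * V p + b * V q) :
    ∀ p ∈ K, ∀ q ∈ K, ∀ a b : ℝ, 0 ≤ a → 0 ≤ b → a + b = 1 →
      V (a • p + b • q) + a * b * (⨅ y : E₂, ⨅ z : E₃, Q (q.1 - p.1, (y, z))) ≤ a * V p + b * V q := by
  intro p hp q hq a b ha hb hab
  rw [iInf_fibre_tower Q hQ0]
  exact secantForm_iInf_fibre hQ0 h p hp q hq a b ha hb hab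

end Tower

/-! ## Toy checks (kernel): the letters are not vacuous -/

/-- Toy: on `ℝ × ℝ` the joint form `Q(x, y) = x² + 2xy + 2y²` (`a = 1, B = 1, C = 2`, `L x = −x∕2`) has Schur form `x²∕2`, and indeed
`x²∕2 ≤ x² + 2xy + 2y²`. -/
example (x y : ℝ) : x ^ 2 / 2 ≤ x ^ 2 + 2 * (x * y) + 2 * y ^ 2 := by nlinarith [sq_nonneg (y + x / 2)]

end Summit.QuantumFields.BalabanUV.T4Continuum.NE7b.ConvexityModulusSchur
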